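import Mathlib
import Summits.NavierStokesRegularity.NavierStokesRegularity.Theorems.EulerZoomLiouvillePowerGaugeEulerLiouvilleDSSEndpointDecay
import Summits.NavierStokesRegularity.NavierStokesRegularity.Theorems.EulerZoomLiouvillePowerGaugeEulerLiouvilleDSSEndpointSliceRiesz
import HarnessLib

/-!
# Rung C2 of the crux `EulerZoomLiouville.PowerGaugeEulerLiouville` at the endpoint `ρ = 1/2`:
# no DISCRETELY self-similar member with power-spread slices (Chae–Shvydkoy Thm 3.1 for DSS
# collapse, inside Seregin's weak class)

Route №10 `EulerZoomLiouville` (NavierStokesRegularity), crux E = stmt-NavierStokesRegularity-19832,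
tenure rung C2 (`Cruxes/PowerGaugeEulerLiouville/Lines/rungC_window.lean`, `Sig.rungC2_dss`) at the
energy-conserving endpoint `ρ = 1/2`.  Closing file of the DSS endpoint chain
(`…DSSEndpointShellTools/Shell/DecayTools/PeriodFlux/Decay/Slices/SliceRiesz`):

* `dss_half_false_of_powerSpread` — let `(u, p, H, c)` satisfy the THREE HYPOTHESES OF THE CRUX at
  `ρ = 1/2` and be DISCRETELY SELF-SIMILAR for the class scaling with a factor `l ≥ 4`
  (`u(τ,y) = l^{1+ρ} u(l^{2+ρ}τ, l y)`, `p(τ,y) = l^{2(1+ρ)} p(l^{2+ρ}τ, l y)`, the shape of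
  `IsDSSPair`).  If on ONE period `(l^{2+ρ} τ₀, τ₀)` a.e. slice has the power spread
  `c₀ |y|^{−(4−δ')} ≤ |u(τ, y)| ≤ C_up |y|^{1−δ}` a.e. for large `|y|` (`δ, δ', c₀ > 0`, `δ ≤ 1`), then
  `False`.  Every per-slice input of `dss_half_period_false_of_powerSpread` is DERIVED from the class:
  finite slice energy (`A`-gauge), `|u(τ)|³, |p(τ)||u(τ)| ∈ L¹_loc` (energy class, Lin's pressure
  class), and the scale-wise Riesz representation of a.e. slice pressure (`D`-gauge + slice Poisson
  identity, `ae_slice_riesz_of_gauge_half`).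
* `dss_half_ae_eq_zero_of_powerSpread` — the same in the conclusion shape of `Sig.rungC2_dss`.
* `dss_half_false_of_powerSpread_pow` — any factor `l > 1`: a DSS member with factor `l` is DSS with
  factor `l^k` (`dss_iterate`), so the hypotheses may be placed on a period of `l^k`, `l^k ≥ 4`.

The factor restriction `l ≥ 4` (equivalently: the power spread is asked on a period of a power
`l^k ≥ 4` of the factor) is bookkeeping of the shell geometry, not a restriction on the member.
This is the DISCRETELY self-similar extension of the lineage's C1 endpoint theorem
`selfSimilar_half_false_of_powerSpread'` (Chae–Shvydkoy 2013, Thm 3.1; DSS decay: Xue 2014,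
Thm 1.1 (ii), there for `C¹_s C³_y` profiles with the Riesz pressure assumed).

WHAT THIS IS NOT: not NS, not E, not rung C2 — one printed-type stratum of C2 at the endpoint, in
the weak class; the DSS endpoint WITHOUT a lower power bound is as open as the self-similar one.
-/

noncomputable section

-- flat `Theorems/<Route><Decl>…` files of one crux share the namespace of the crux (tree convention)
set_option linter.dupNamespace false

open MeasureTheory Set Filter Topology Metric Function TopologicalSpace
open scoped ENNReal NNReal InnerProductSpace RealInnerProductSpace

namespace Summit.NavierStokesRegularity.NavierStokesRegularity.Theorems.PowerGaugeEulerLiouville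

open Literature.Analysis Literature.Analysis.FunctionSpaces Literature.Analysis.FluidPDE

section Member

variable {u : ℝ → EuclideanSpace ℝ (Fin 3) → EuclideanSpace ℝ (Fin 3)}
  {p : ℝ → EuclideanSpace ℝ (Fin 3) → ℝ}
  {H : ℝ → EuclideanSpace ℝ (Fin 3) → EuclideanSpace ℝ (Fin 3) →L[ℝ] EuclideanSpace ℝ (Fin 3)}
  {c : ℝ≥0}

/-- **Iterating the DSS factor.**  A pair which is discretely self-similar with factor `l > 0` for
the class scaling with exponent `ρ` is discretely self-similar with factor `l^k`, every `k : ℕ`.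
[folklore] -/
theorem dss_iterate {ρ l : ℝ} (hl : 0 < l)
    (hu : ∀ τ : ℝ, τ < 0 → ∀ y, u τ y = (l ^ (1 + ρ)) • u ((l ^ (2 + ρ)) * τ) (l • y))
    (hp : ∀ τ : ℝ, τ < 0 → ∀ y, p τ y = (l ^ (2 * (1 + ρ))) * p ((l ^ (2 + ρ)) * τ) (l • y))
    (k : ℕ) :
    (∀ τ : ℝ, τ < 0 → ∀ y, u τ y = ((l ^ k) ^ (1 + ρ)) • u (((l ^ k) ^ (2 + ρ)) * τ) ((l ^ k) • y)) ∧
    (∀ τ : ℝ, τ < 0 → ∀ y,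
      p τ y = ((l ^ k) ^ (2 * (1 + ρ))) * p (((l ^ k) ^ (2 + ρ)) * τ) ((l ^ k) • y)) := by
  induction k with
  | zero =>
    refine ⟨fun τ _ y => ?_, fun τ _ y => ?_⟩ <;> simp
  | succ k ih =>
    obtain ⟨ihu, ihp⟩ := ih
    have hlk : 0 < l ^ k := pow_pos hl k
    have hb : 0 < (l ^ k) ^ (2 + ρ) := Real.rpow_pos_of_pos hlk _
    have e1 : ∀ s : ℝ, (l ^ (k + 1)) ^ s = (l ^ k) ^ s * l ^ s := fun s => by
      rw [pow_succ, Real.mul_rpow hlk.le hl.le]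
    refine ⟨fun τ hτ y => ?_, fun τ hτ y => ?_⟩
    · have hτ' : (l ^ k) ^ (2 + ρ) * τ < 0 := mul_neg_of_pos_of_neg hb hτ
      rw [ihu τ hτ y, hu _ hτ' ((l ^ k) • y), smul_smul, smul_smul, ← mul_assoc, e1 (1 + ρ),
        e1 (2 + ρ), pow_succ]
      congr 2
      · ring
      · rw [mul_comm]
    · have hτ' : (l ^ k) ^ (2 + ρ) * τ < 0 := mul_neg_of_pos_of_neg hb hτ
      rw [ihp τ hτ y, hp _ hτ' ((l ^ k) • y), smul_smul, ← mul_assoc, ← mul_assoc, e1 (2 * (1 + ρ)),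
        e1 (2 + ρ), pow_succ]
      congr 2
      · ring
      · rw [mul_comm]

/-- **No DSS member with power-spread slices at the endpoint (Chae–Shvydkoy Thm 3.1 for DSS
collapse, weak class).**  See the module docstring; the factor is `l ≥ 4` (place the power spread
on a period of a power `l^k ≥ 4` for smaller factors: `dss_half_false_of_powerSpread_pow`).
[cite: ChaeShvydkoy2013, §3.1 Thm. 3.1; Xue2014DSSEuler, Thm 1.1 (ii)] -/
theorem dss_half_false_of_powerSpread {ρ : ℝ} (hρ : ρ = 1 / 2)
    (hsw : IsSuitableWeakSolutionOn (slab (EuclideanSpace ℝ (Fin 3)) (Iio 0) isOpen_Iio) 0 0 u p)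
    (hH : HasWeakSpatialGradientOn (slab (EuclideanSpace ℝ (Fin 3)) (Iio 0) isOpen_Iio) u H)
    (hgauge : ∀ a : ℝ, 0 < a →
      ENNReal.ofReal (a ^ (2 * ρ)) * cknA a (0 : ℝ × EuclideanSpace ℝ (Fin 3)) u +
          ENNReal.ofReal (a ^ ρ) * cknE a (0 : ℝ × EuclideanSpace ℝ (Fin 3)) H +
        ENNReal.ofReal (a ^ (2 * ρ)) * cknD a (0 : ℝ × EuclideanSpace ℝ (Fin 3)) p ≤ (c : ℝ≥0∞))
    {l : ℝ} (hl : 4 ≤ l)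
    (hu : ∀ τ : ℝ, τ < 0 → ∀ y, u τ y = (l ^ (1 + ρ)) • u ((l ^ (2 + ρ)) * τ) (l • y))
    (hp : ∀ τ : ℝ, τ < 0 → ∀ y, p τ y = (l ^ (2 * (1 + ρ))) * p ((l ^ (2 + ρ)) * τ) (l • y))
    {τ₀ : ℝ} (hτ₀ : τ₀ < 0)
    {δ Cup R₀ : ℝ} (hδ : 0 < δ) (hδ1 : δ ≤ 1) (hCup : 0 ≤ Cup)
    (hup : ∀ᵐ τ : ℝ, τ ∈ Ioo ((l ^ (2 + ρ)) * τ₀) τ₀ →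
      ∀ᵐ y ∂volume, R₀ ≤ ‖y‖ → ‖u τ y‖ ≤ Cup * ‖y‖ ^ (1 - δ))
    {c₀ δ' R₀' : ℝ} (hc₀ : 0 < c₀) (hδ' : 0 < δ')
    (hlow : ∀ᵐ τ : ℝ, τ ∈ Ioo ((l ^ (2 + ρ)) * τ₀) τ₀ →
      ∀ᵐ y ∂volume, R₀' ≤ ‖y‖ → c₀ * ‖y‖ ^ (-(4 - δ')) ≤ ‖u τ y‖) : False := by
  subst hρ
  have hl0 : 0 < l := by linarith
  -- the gauges separately
  have hA : ∀ a : ℝ, 0 < a → ENNReal.ofReal (a ^ (2 * (1 / 2 : ℝ))) *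
      cknA a (0 : ℝ × EuclideanSpace ℝ (Fin 3)) u ≤ (c : ℝ≥0∞) :=
    fun a ha => le_trans (le_trans le_self_add le_self_add) (hgauge a ha)
  have hD : ∀ a : ℝ, 0 < a → ENNReal.ofReal (a ^ (2 * (1 / 2 : ℝ))) *
      cknD a (0 : ℝ × EuclideanSpace ℝ (Fin 3)) p ≤ (c : ℝ≥0∞) :=
    fun a ha => le_trans le_add_self (hgauge a ha)
  -- the exponents of the scaling at `ρ = 1/2`
  have e1 : (1 : ℝ) + 1 / 2 = 3 / 2 := by norm_num
  have e2 : (2 : ℝ) + 1 / 2 = 5 / 2 := by norm_num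
  have e3 : l ^ (2 * (1 + 1 / 2 : ℝ)) = l ^ 3 := by
    rw [show (2 : ℝ) * (1 + 1 / 2) = (3 : ℕ) by norm_num, Real.rpow_natCast]
  rw [e2] at hup hlow
  have hu' : ∀ τ : ℝ, τ < 0 → ∀ y, u τ y = (l ^ (3 / 2 : ℝ)) • u (l ^ (5 / 2 : ℝ) * τ) (l • y) := by
    intro τ hτ y; rw [hu τ hτ y, e1, e2]
  have hp' : ∀ τ : ℝ, τ < 0 → ∀ y, p τ y = l ^ 3 * p (l ^ (5 / 2 : ℝ) * τ) (l • y) := by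
    intro τ hτ y; rw [hp τ hτ y, e3, e2]
  -- per-slice inputs from the class
  have hum : AEStronglyMeasurable (uncurry u)
      (volume.restrict (Iio (0 : ℝ) ×ˢ (univ : Set (EuclideanSpace ℝ (Fin 3))))) := by
    have := hH.locallyIntegrableOn.aestronglyMeasurable
    simpa [slab] using this
  have hE := ae_slice_energy_of_gauge_half hum hA
  have h3 := ae_slice_cube_locallyIntegrable hsw
  have hPV := ae_slice_pressure_velocity_locallyIntegrable hsw
  have hPR := ae_slice_riesz_of_gauge_half hsw hA hD hτ₀ hδ1 (by linarith) hCup hup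
  -- the lower exponent may be taken `≤ 4`
  have hlow' : ∀ᵐ τ : ℝ, τ ∈ Ioo (l ^ (5 / 2 : ℝ) * τ₀) τ₀ →
      ∀ᵐ y ∂volume, max R₀' 1 ≤ ‖y‖ → c₀ * ‖y‖ ^ (-(4 - min δ' 4)) ≤ ‖u τ y‖ := by
    filter_upwards [hlow] with τ hτ hτI
    filter_upwards [hτ hτI] with y hy hyR
    have hy1 : 1 ≤ ‖y‖ := (le_max_right _ _).trans hyR
    refine le_trans ?_ (hy ((le_max_left _ _).trans hyR))
    exact mul_le_mul_of_nonneg_left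
      (Real.rpow_le_rpow_of_exponent_le hy1 (by linarith [min_le_left δ' 4])) hc₀.le
  exact dss_half_period_false_of_powerSpread hsw hl hu' hp' hτ₀ hE h3 hPV hδ hδ1 hCup hup
    (R₁ := 1) hPR hc₀ (lt_min hδ' four_pos) (min_le_right _ _) hlow'

/-- **The DSS power-spread stratum of rung C2 at the endpoint, `Sig.rungC2_dss`-shaped.**
[cite: ChaeShvydkoy2013, §3.1 Thm. 3.1] -/
theorem dss_half_ae_eq_zero_of_powerSpread {ρ : ℝ} (hρ : ρ = 1 / 2)
    (hsw : IsSuitableWeakSolutionOn (slab (EuclideanSpace ℝ (Fin 3)) (Iio 0) isOpen_Iio) 0 0 u p)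
    (hH : HasWeakSpatialGradientOn (slab (EuclideanSpace ℝ (Fin 3)) (Iio 0) isOpen_Iio) u H)
    (hgauge : ∀ a : ℝ, 0 < a →
      ENNReal.ofReal (a ^ (2 * ρ)) * cknA a (0 : ℝ × EuclideanSpace ℝ (Fin 3)) u +
          ENNReal.ofReal (a ^ ρ) * cknE a (0 : ℝ × EuclideanSpace ℝ (Fin 3)) H +
        ENNReal.ofReal (a ^ (2 * ρ)) * cknD a (0 : ℝ × EuclideanSpace ℝ (Fin 3)) p ≤ (c : ℝ≥0∞))
    {l : ℝ} (hl : 4 ≤ l)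
    (hu : ∀ τ : ℝ, τ < 0 → ∀ y, u τ y = (l ^ (1 + ρ)) • u ((l ^ (2 + ρ)) * τ) (l • y))
    (hp : ∀ τ : ℝ, τ < 0 → ∀ y, p τ y = (l ^ (2 * (1 + ρ))) * p ((l ^ (2 + ρ)) * τ) (l • y))
    {τ₀ : ℝ} (hτ₀ : τ₀ < 0)
    {δ Cup R₀ : ℝ} (hδ : 0 < δ) (hδ1 : δ ≤ 1) (hCup : 0 ≤ Cup)
    (hup : ∀ᵐ τ : ℝ, τ ∈ Ioo ((l ^ (2 + ρ)) * τ₀) τ₀ →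
      ∀ᵐ y ∂volume, R₀ ≤ ‖y‖ → ‖u τ y‖ ≤ Cup * ‖y‖ ^ (1 - δ))
    {c₀ δ' R₀' : ℝ} (hc₀ : 0 < c₀) (hδ' : 0 < δ')
    (hlow : ∀ᵐ τ : ℝ, τ ∈ Ioo ((l ^ (2 + ρ)) * τ₀) τ₀ →
      ∀ᵐ y ∂volume, R₀' ≤ ‖y‖ → c₀ * ‖y‖ ^ (-(4 - δ')) ≤ ‖u τ y‖) :
    uncurry u =ᵐ[volume.restrict (Iio (0 : ℝ) ×ˢ (univ : Set (EuclideanSpace ℝ (Fin 3))))] 0 :=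
  (dss_half_false_of_powerSpread hρ hsw hH hgauge hl hu hp hτ₀ hδ hδ1 hCup hup hc₀ hδ' hlow).elim

/-- **Any factor `l > 1`.**  A DSS member with factor `l > 1` is DSS with factor `l^k`
(`dss_iterate`); with the power spread on one period `((l^k)^{2+ρ} τ₀, τ₀)` of a power `l^k ≥ 4`
the member is impossible. [cite: ChaeShvydkoy2013, §3.1 Thm. 3.1] -/
theorem dss_half_false_of_powerSpread_pow {ρ : ℝ} (hρ : ρ = 1 / 2)
    (hsw : IsSuitableWeakSolutionOn (slab (EuclideanSpace ℝ (Fin 3)) (Iio 0) isOpen_Iio) 0 0 u p)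
    (hH : HasWeakSpatialGradientOn (slab (EuclideanSpace ℝ (Fin 3)) (Iio 0) isOpen_Iio) u H)
    (hgauge : ∀ a : ℝ, 0 < a →
      ENNReal.ofReal (a ^ (2 * ρ)) * cknA a (0 : ℝ × EuclideanSpace ℝ (Fin 3)) u +
          ENNReal.ofReal (a ^ ρ) * cknE a (0 : ℝ × EuclideanSpace ℝ (Fin 3)) H +
        ENNReal.ofReal (a ^ (2 * ρ)) * cknD a (0 : ℝ × EuclideanSpace ℝ (Fin 3)) p ≤ (c : ℝ≥0∞))
    {l : ℝ} (hl : 1 < l)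
    (hu : ∀ τ : ℝ, τ < 0 → ∀ y, u τ y = (l ^ (1 + ρ)) • u ((l ^ (2 + ρ)) * τ) (l • y))
    (hp : ∀ τ : ℝ, τ < 0 → ∀ y, p τ y = (l ^ (2 * (1 + ρ))) * p ((l ^ (2 + ρ)) * τ) (l • y))
    {k : ℕ} (hk : 4 ≤ l ^ k) {τ₀ : ℝ} (hτ₀ : τ₀ < 0)
    {δ Cup R₀ : ℝ} (hδ : 0 < δ) (hδ1 : δ ≤ 1) (hCup : 0 ≤ Cup)
    (hup : ∀ᵐ τ : ℝ, τ ∈ Ioo (((l ^ k) ^ (2 + ρ)) * τ₀) τ₀ →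
      ∀ᵐ y ∂volume, R₀ ≤ ‖y‖ → ‖u τ y‖ ≤ Cup * ‖y‖ ^ (1 - δ))
    {c₀ δ' R₀' : ℝ} (hc₀ : 0 < c₀) (hδ' : 0 < δ')
    (hlow : ∀ᵐ τ : ℝ, τ ∈ Ioo (((l ^ k) ^ (2 + ρ)) * τ₀) τ₀ →
      ∀ᵐ y ∂volume, R₀' ≤ ‖y‖ → c₀ * ‖y‖ ^ (-(4 - δ')) ≤ ‖u τ y‖) : False := by
  obtain ⟨hu', hp'⟩ := dss_iterate (lt_trans zero_lt_one hl) hu hp k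
  exact dss_half_false_of_powerSpread hρ hsw hH hgauge hk hu' hp' hτ₀ hδ hδ1 hCup hup hc₀ hδ' hlow

end Member

end Summit.NavierStokesRegularity.NavierStokesRegularity.Theorems.PowerGaugeEulerLiouville
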